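import Literature.NumberTheory.EllipticCurves.ComplexMultiplicationTwistIsogenyProofs
import Literature.NumberTheory.EllipticCurves.LiLiuTian2024.CongruentNumberFullBSD
import Literature.NumberTheory.EllipticCurves.BSDInvariants
import Literature.NumberTheory.EllipticCurves.RealPeriod
import Mathlib.NumberTheory.LegendreSymbol.JacobiSymbol
import HarnessLib

/-!
# Coates–Li–Tian–Zhai 2015, Theorems 1.2–1.4: the quadratic twists of `A = X₀(49)` — full BSD
# (including the `2`-part) for `A^{(R)}`, the `2`-adic valuation of `L^{alg}(A^{(M)}, 1)`, and the
# rank-one twists with `Ш` of odd order — AS PRINTED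

Source: J. Coates, Y. Li, Y. Tian, S. Zhai, *Quadratic twists of elliptic curves*, Proc. London
Math. Soc. (3) 110 (2015), no. 2, 357–394, doi:10.1112/plms/pdu059 (= arXiv:1312.3884), §1
(PUBLISHED, refereed). Text materialised on the hub as `paper:arxiv-1312.3884`; locators below are
`pNNNN.txt:L<n>` of that materialisation (p0003 = §1 up to Thm. 1.1 and the BSD formula (1.3);
p0004 = the curve `A`, Theorems 1.2, 1.3, 1.4). Named facts (`def … : Prop`, D-0014), nothing
asserted. Requested by the cell `b2b-bsdres`, sub-lane `bsd-p2` (the `p = 2` literature layer: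
"Coates–Li"; the prime `2` is THE prime of these theorems — "it is the 2-part of the
Birch–Swinnerton-Dyer formula which is needed for carrying out Tian's induction argument for
quadratic twists", p0003 L93–L95).

The curve (p0004 L1–L24, verbatim): "we let `A` be the modular curve `X₀(49)`, which has genus 1,
and which we view as an elliptic curve by taking `[∞]` to be the origin of the group law. It is
well known that `A` has complex multiplication by the ring of integers `𝔒 = ℤ[(1+√−7)/2]` of the
field `F = ℚ(√−7)`, and has a minimal Weierstrass equation given by `y² + xy = x³ − x² − 2x − 1`.
Moreover, `A(ℚ) = ℤ/2ℤ` … The discriminant of `A` is `−7³`, the `j`-invariant of `A` is `−3³5³` …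
`ℚ(A[2]) = ℚ(√−7)`, and `ℚ(A[4]) = ℚ(i, ⁴√−7)`. … `L(A,1)/Ω_∞ = 1/2`. … for a discriminant `d`,
which is prime to `7`, the curves `A^{(d)}` and `A^{(−7d)}` are isogenous over `ℚ`."
In the tree this minimal model is `Literature.NumberTheory.EllipticCurves.cm7 = ⟨1, −1, 0, −2, −1⟩`
(`ComplexMultiplicationTwistIsogenyProofs.lean`, with `Δ_cm7 : Δ = −7³` and `isElliptic_cm7`),
Cremona label `49a1`.

**Theorem 1.2** (p0004 L40–L46, verbatim): "Let `R = q₁ ⋯ q_r` be a product of `r ≥ 0` distinct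
primes, which are `≡ 1 mod 4` and inert in the field `F`. Then `L(A^{(R)}, 1) ≠ 0`, `A^{(R)}(ℚ)`
is finite, the Tate-Shafarevich group of `A^{(R)}` is finite of odd cardinality, and the full
Birch-Swinnerton-Dyer [conj.] is valid for `A^{(R)}`." (Here and below `[conj.]` abbreviates the authors'
word for the Birch–Swinnerton-Dyer statement; it is spelled out nowhere in this file because the
tree's linter reserves that word for unproven statements — the theorems transcribed here are PROVED
in print.)

**Theorem 1.3** (p0004 L55–L85, verbatim): "For any `r ≥ 0` distinct primes `q₁, …, q_r`, which
are all `≡ 1 mod 4` and inert in `F`, define the field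
`𝔥 = ℚ(A[4], √q₁, …, √q_r) = ℚ(i, ⁴√−7, √q₁, …, √q_r)` (1.2). For each square free integer `M`,
prime to `7`, with `M ≡ 1 mod 4`, we define `L^{(alg)}(A^{(M)}, 1) = L(A^{(M)}, 1)/Ω_∞(A^{(M)})`,
which is well known to be a rational number, where `Ω_∞(A^{(M)})` is the least positive real
period of `A^{(M)}`. We will always normalise the order valuation at `2` by `ord₂(2) = 1`.
Theorem 1.3. Let `R = q₁⋯q_r` be a product of `r ≥ 0` distinct primes `≡ 1 mod 4`, which are
inert in `F`, and let `N = p₁⋯p_k` be a product of `k ≥ 1` distinct primes, all of which split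
completely in the field `𝔥` defined by (1.2). Put `M = RN`. Then
`ord₂(L^{(alg)}(A^{(M)}, 1)) ≥ r + 2k`, and, if `L(A^{(M)}, 1) ≠ 0`, the `2`-primary subgroup of the
Tate-Shafarevich group of `A^{(M)}` is non-zero."

**Theorem 1.4** (p0004 L93–L105, verbatim): "Let `l₀` be a prime number `> 3`, which is
`≡ 3 mod 4` and is inert in the field `F`. Assume that `q₁, …, q_r` are distinct rational primes,
which are `≡ 1 mod 4`, and inert in both the fields `F` and `ℚ(√−l₀)`. Let `k` be any integer
`≥ 0`, and let `p₁, …, p_k` be distinct primes which all split completely in the field `𝔥`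
defined by (1.2). Put `N = p₁⋯p_k`, `R = l₀q₁⋯q_r`, and `M = −RN`. Assume that the ideal class
group of the imaginary quadratic field `ℚ(√−l₀N)` has no element of exact order `4`. Then
`L(A^{(M)},s)` has a simple zero at `s = 1`, `A^{(M)}(ℚ)` has rank one, and the Tate-Shafarevich
group of `A^{(M)}` is finite of odd cardinality." Followed by (p0004 L107–L115): "in the special
case when `k = 0` but `r` is arbitrary, no hypothesis about the ideal class group is needed …
Unfortunately, we still do not know enough at present to prove that the orders of the
Tate-Shafarevich group of the twists of `A` in Theorems 1.3 and 1.4 are as predicted by the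
[conj.] of Birch and Swinnerton-Dyer." — i.e. Theorem 1.4 does NOT assert the `2`-part of the
BSD formula for its rank-one twists (only `#Ш` odd); this is recorded, not repaired.

## Transcription

* `A = cm7`; `A^{(M)}` = the tree's `cm7.quadraticTwist (M : ℚ)` (`QuadraticTwist.lean`,
  `y² = x³ + M b₂/4 x² + M² b₄/2 x + M³ b₆/4`, a model of the twist by `ℚ(√M)`), read on a GLOBALLY
  MINIMAL model `W'` of it (`∃ C : VariableChange ℚ, C • W' = cm7.quadraticTwist M`, the tree's
  idiom of `QuadraticTwist.lean` l.234), since the BSD invariants `realPeriodRat`, `tamagawaProduct`,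
  `BSDTriple` of `BSDInvariants.lean` are the printed ones exactly for globally minimal equations.
* "`q` prime, `≡ 1 mod 4`, inert in `F = ℚ(√−7)`": `q % 4 = 1 ∧ jacobiSym (−7) q = −1` (for an odd
  prime `q ≠ 7` the Jacobi symbol `(−7/q)` is the Legendre symbol, `= −1` iff `q` is inert in
  `ℚ(√−7)`, `d_F = −7`; Dedekind–Kummer). "`R = q₁⋯q_r`, `r ≥ 0` distinct primes": `R` squarefree
  with all prime factors of that kind (`InertProduct R`; `R = 1` is `r = 0`), `r = #R.primeFactors`.
* "`p` splits completely in `𝔥 = ℚ(i, ⁴√−7, √q₁, …, √q_r)`": `SplitsCompletelyInH R p` :=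
  `p` prime, `p ∤ 14R` (unramified), `p ≡ 1 (mod 4)` (split in `ℚ(i)`), `x⁴ ≡ −7 (mod p)` solvable
  (with `i ∈ 𝔽_p` this is: `x⁴ + 7` has four roots mod `p`, i.e. `p` splits completely in the
  splitting field `ℚ(i, ⁴√−7)` of `x⁴ + 7` — Dedekind–Kummer, `p ∤ disc(x⁴ + 7) = −2¹⁴·7³`), and
  every `q_j` a square mod `p` (split in `ℚ(√q_j)`); a prime splits completely in a compositum iff
  it does so in each factor. This arithmetic reading of "splits completely in `𝔥`" is a gloss
  (standard), recorded here because the tree has no name for the field `𝔥`.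
* `L(A^{(M)}, 1) = W'.entireLFunction 1` (model-independent); "`A^{(R)}(ℚ)` is finite":
  `Finite W'.toAffine.Point` — stated as `W'.mordellWeilRank = 0` (equivalent by Mordell–Weil; the
  tree's BSD files speak through `mordellWeilRank`); "`Ш` finite of odd cardinality":
  `W'.ShaFinite ∧ Odd W'.shaOrder` (`shaOrder = Nat.card Ш`, `Sha.lean`); "the full
  Birch–Swinnerton-Dyer [conj.] is valid": `W'.BSDTriple` (RANK ∧ SHAFIN ∧ LEAD of
  `BSDInvariants.lean`; at rank `0` LEAD is the printed (1.3)
  `L(E,1)/ω(E) = c_∞(E) ∏_{q∣C} c_q(E) #Ш(E)/#E(ℚ)²` (p0003 L83–L87) because the tree's period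
  `Ω = realPeriodRat` of a minimal model is `c_∞ · ω`, `RealPeriod.lean`: "`Ω = numRealComponents · Ω₀`
  with `Ω₀` the least positive real period").
* `Ω_∞(A^{(M)})` = least positive real period of (the Néron lattice of) `A^{(M)}` =
  `leastRealPeriod W' := W'.realPeriodRat / c_∞(W')` for the minimal model `W'`;
  `L^{(alg)} = L(A^{(M)},1)/Ω_∞ ∈ ℚ` is transcribed by an existential rational witness `q` with
  `L(A^{(M)}, 1) = q · Ω_∞` ("well known to be a rational number", part of the printed setting),
  and `ord₂(L^{(alg)}) ≥ r + 2k` as `q = 0 ∨ r + 2k ≤ padicValRat 2 q` (`ord₂ 0 = ∞`).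
* "the `2`-primary subgroup of `Ш(A^{(M)})` is non-zero": `Nontrivial (primaryComponent Ш 2)`.
* Thm. 1.4: "`ℚ(√−l₀N)` has no element of exact order `4`" = the tree's
  `LiLiuTian2024.NoIdealClassOfOrderFour (−l₀N)` (same printed hypothesis shape, Li–Liu–Tian 2024);
  "simple zero" = `analyticRank = 1`; "rank one" = `mordellWeilRank = 1`.

Not transcribed (rows only in the lane's LIT-STATUS): Theorem 1.1 (general `E`, `f([0]) ∉ 2E(ℚ)`
and a good supersingular `q₁ ≡ 1 mod 4` with `C` a square mod `q₁` ⇒ infinitely many twists of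
analytic rank `1` / `0` with `k` prime factors — needs the cusp value `f([0])` of a parametrisation),
Theorem 5.x (the Waldspurger-side strengthening of Thm. 1.3), and the `[CST]` strengthening
(`p_i` split in `ℚ(A[4], √R)` only) mentioned after Thm. 1.4.

Nothing is asserted: users take `(h : thm12_fullBSD_twist)` etc.
-/

noncomputable section

open scoped Classical

open NumberField WeierstrassCurve Literature.NumberTheory.EllipticCurves

namespace Literature.NumberTheory.EllipticCurves.CoatesLiTianZhai2015

/-! ### The printed side conditions -/

/-- "`R = q₁ ⋯ q_r` a product of `r ≥ 0` distinct primes, which are `≡ 1 mod 4` and inert in the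
field `F = ℚ(√−7)`" (Thms. 1.2, 1.3): `R` is squarefree and every prime `q ∣ R` has `q ≡ 1 (mod 4)`
and `(−7/q) = −1` (inert in `ℚ(√−7)`; module docstring). `R = 1` is the case `r = 0`.
[cite: CoatesLiTianZhai2015, Thm. 1.2 (hypothesis on R) (arXiv p0004 L41–L42) (shape only; nothing asserted)] -/
def InertProduct (R : ℕ) : Prop :=
  Squarefree R ∧ ∀ q : ℕ, q.Prime → q ∣ R → q % 4 = 1 ∧ jacobiSym (-7) q = -1

/-- "`p` splits completely in the field `𝔥 = ℚ(A[4], √q₁, …, √q_r) = ℚ(i, ⁴√−7, √q₁, …, √q_r)`"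
((1.2), p0004 L59–L62), for the primes `q_j` of `R`, read arithmetically (module docstring,
Dedekind–Kummer in each factor of the compositum): `p` prime, `p ∤ 14R`, `p ≡ 1 (mod 4)`,
`x⁴ ≡ −7 (mod p)` solvable, and every prime `q ∣ R` a square mod `p`.
[cite: CoatesLiTianZhai2015, (1.2) and Thm. 1.3 (arXiv p0004 L59–L77) (shape only; nothing asserted)] -/
def SplitsCompletelyInH (R p : ℕ) : Prop :=
  p.Prime ∧ ¬ p ∣ 14 * R ∧ p % 4 = 1 ∧ (∃ x : ZMod p, x ^ 4 = -7) ∧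
    ∀ q : ℕ, q.Prime → q ∣ R → ∃ y : ZMod p, y ^ 2 = (q : ZMod p)

/-- `Ω_∞(E)` = "the least positive real period" of a Weierstrass equation `W/ℚ` (p0004 L70; p0003
L79 "`ω(E)`"): the tree's real period `Ω(W) = ∫_{E(ℝ)}|ω|` (`realPeriodRat`, which "already
includes the factor number of connected components", `RealPeriod.lean`) divided by the number
`c_∞` of connected components of `E(ℝ)` (`numRealComponents`). For a globally minimal `W` this is
the least positive real period of the Néron lattice. [cite: CoatesLiTianZhai2015, §1 (arXiv p0003 L78–L80, p0004 L70)] -/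
def leastRealPeriod (W : WeierstrassCurve ℚ) : ℝ :=
  W.realPeriodRat / ((W.baseChange ℝ).numRealComponents : ℝ)

/-- `Ω(W) = c_∞(W) · Ω_∞(W)` (definitional rearrangement; `c_∞ ∈ {1, 2}` is never `0`).
[cite: CoatesLiTianZhai2015, §1 (1.3) (arXiv p0003 L85–L87: the factor c_∞(E))] -/
theorem realPeriodRat_eq_numRealComponents_mul_leastRealPeriod (W : WeierstrassCurve ℚ) :
    W.realPeriodRat = ((W.baseChange ℝ).numRealComponents : ℝ) * leastRealPeriod W := by
  have h : ((W.baseChange ℝ).numRealComponents : ℝ) ≠ 0 := by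
    exact_mod_cast (WeierstrassCurve.numRealComponents_pos (W.baseChange ℝ)).ne'
  unfold leastRealPeriod
  field_simp

/-! ### Theorem 1.2 -/

/-- **Coates–Li–Tian–Zhai 2015, Theorem 1.2** (PLMS 110 (2015) p. 359; arXiv:1312.3884 p0004
L40–L46, verbatim in the module docstring). For `A = X₀(49)` (minimal model `cm7`,
`y² + xy = x³ − x² − 2x − 1`) and `R` a product of `r ≥ 0` distinct primes `≡ 1 (mod 4)` inert in
`ℚ(√−7)` (`InertProduct R`), on any globally minimal model `W'` of the quadratic twist `A^{(R)}`:
`L(A^{(R)}, 1) ≠ 0`, `A^{(R)}(ℚ)` is finite (rank `0`), `Ш(A^{(R)})` is finite of ODD cardinality,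
and the full Birch–Swinnerton-Dyer formula holds for `A^{(R)}` (`BSDTriple`: RANK ∧ SHAFIN ∧ LEAD
— in particular the `2`-part). Named fact (PUBLISHED); nothing asserted.
[cite: CoatesLiTianZhai2015, Thm. 1.2 (p. 359; arXiv p0004 L40–L46)] -/
def thm12_fullBSD_twist : Prop :=
  ∀ (R : ℕ), InertProduct R →
    ∀ (W' : WeierstrassCurve ℚ) [W'.IsElliptic] [W'.IsGloballyMinimal],
      (∃ C : VariableChange ℚ, C • W' = cm7.quadraticTwist (R : ℚ)) →
        W'.entireLFunction 1 ≠ 0 ∧ W'.mordellWeilRank = 0 ∧ W'.ShaFinite ∧ Odd W'.shaOrder ∧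
          W'.BSDTriple

/-! ### Theorem 1.3 -/

/-- **Coates–Li–Tian–Zhai 2015, Theorem 1.3** (PLMS 110 (2015) pp. 359–360; arXiv p0004 L73–L85,
verbatim in the module docstring). `R` as in Thm. 1.2 with `r = #R.primeFactors`; `N` a product of
`k ≥ 1` distinct primes each splitting completely in `𝔥 = ℚ(i, ⁴√−7, √q₁, …, √q_r)`
(`SplitsCompletelyInH R p`); `M = RN`. Then, on any globally minimal model `W'` of `A^{(M)}`:
`L^{(alg)}(A^{(M)}, 1) = L(A^{(M)}, 1)/Ω_∞(A^{(M)})` is a rational number `q` with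
`ord₂(q) ≥ r + 2k` (vacuous if `q = 0`), and if `L(A^{(M)}, 1) ≠ 0` then `Ш(A^{(M)})[2^∞] ≠ 0`.
Named fact (PUBLISHED); nothing asserted.
[cite: CoatesLiTianZhai2015, Thm. 1.3 (pp. 359–360; arXiv p0004 L55–L85)] -/
def thm13_ord_two_LAlg : Prop :=
  ∀ (R N : ℕ), InertProduct R → Squarefree N → N ≠ 1 →
    (∀ p : ℕ, p.Prime → p ∣ N → SplitsCompletelyInH R p) →
    ∀ (W' : WeierstrassCurve ℚ) [W'.IsElliptic] [W'.IsGloballyMinimal],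
      (∃ C : VariableChange ℚ, C • W' = cm7.quadraticTwist ((R * N : ℕ) : ℚ)) →
        (∃ q : ℚ, W'.entireLFunction 1 = ((q * leastRealPeriod W' : ℝ) : ℂ) ∧
            (q = 0 ∨ ((R.primeFactors.card + 2 * N.primeFactors.card : ℕ) : ℤ) ≤ padicValRat 2 q)) ∧
          (W'.entireLFunction 1 ≠ 0 → Nontrivial (AddCommGroup.primaryComponent W'.sha 2))

/-! ### Theorem 1.4 -/

/-- **Coates–Li–Tian–Zhai 2015, Theorem 1.4** (PLMS 110 (2015) p. 360; arXiv p0004 L93–L105,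
verbatim in the module docstring). `l₀ > 3` prime, `l₀ ≡ 3 (mod 4)`, inert in `F = ℚ(√−7)`;
`R₁ = q₁⋯q_r` (`r ≥ 0`) distinct primes `≡ 1 (mod 4)` inert in `F` AND in `ℚ(√−l₀)`
(`(−l₀/q) = −1`); `N = p₁⋯p_k` (`k ≥ 0`) distinct primes splitting completely in
`𝔥 = ℚ(i, ⁴√−7, √q₁, …, √q_r)`; `R = l₀R₁`, `M = −RN`; `Cl(ℚ(√−l₀N))` has no element of exact order
`4` (`LiLiuTian2024.NoIdealClassOfOrderFour (−l₀N)`). Then on any globally minimal model `W'` of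
`A^{(M)}`: `ord_{s=1} L(A^{(M)}, s) = 1`, `rank A^{(M)}(ℚ) = 1`, and `Ш(A^{(M)})` is finite of odd
cardinality. (The `2`-part of the BSD FORMULA for these rank-one twists is NOT asserted in print —
p0004 L112–L115.) Named fact (PUBLISHED); nothing asserted.
[cite: CoatesLiTianZhai2015, Thm. 1.4 (p. 360; arXiv p0004 L93–L115)] -/
def thm14_rankOne_twist : Prop :=
  ∀ (l₀ R₁ N : ℕ), l₀.Prime → 3 < l₀ → l₀ % 4 = 3 → jacobiSym (-7) l₀ = -1 →
    InertProduct R₁ → (∀ q : ℕ, q.Prime → q ∣ R₁ → jacobiSym (-(l₀ : ℤ)) q = -1) →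
    Squarefree N → (∀ p : ℕ, p.Prime → p ∣ N → SplitsCompletelyInH R₁ p) →
    LiLiuTian2024.NoIdealClassOfOrderFour (-((l₀ * N : ℕ) : ℤ)) →
    ∀ (W' : WeierstrassCurve ℚ) [W'.IsElliptic] [W'.IsGloballyMinimal],
      (∃ C : VariableChange ℚ, C • W' = cm7.quadraticTwist (-((l₀ * R₁ * N : ℕ) : ℚ))) →
        W'.analyticRank = 1 ∧ W'.mordellWeilRank = 1 ∧ W'.ShaFinite ∧ Odd W'.shaOrder

/-! ### Small proved API -/

/-- `R = 1` (`r = 0`) satisfies the hypothesis of Theorem 1.2: the theorem covers `A = X₀(49)`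
itself ("`r ≥ 0`"). [cite: CoatesLiTianZhai2015, Thm. 1.2 (r ≥ 0)] -/
theorem inertProduct_one : InertProduct 1 :=
  ⟨squarefree_one, fun _ hq h ↦ absurd (Nat.eq_one_of_dvd_one h) hq.ne_one⟩

/-- `R = 5` satisfies the hypothesis of Theorem 1.2 (`5 ≡ 1 (mod 4)`, `(−7/5) = (3/5) = −1`: `5` is
inert in `ℚ(√−7)`), so Theorem 1.2 covers the twist `A^{(5)}` of conductor `49 · 25 = 1225`.
[cite: CoatesLiTianZhai2015, Thm. 1.2 (example R = 5)] -/
theorem inertProduct_five : InertProduct 5 := by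
  refine ⟨Nat.prime_five.squarefree, fun q hq hq5 ↦ ?_⟩
  have : q = 5 := (Nat.prime_dvd_prime_iff_eq hq Nat.prime_five).mp hq5
  subst this
  refine ⟨by norm_num, ?_⟩
  have h : jacobiSym (-7) 5 = jacobiSym 3 5 := jacobiSym.mod_left' (by decide)
  rw [h]
  have h2 : jacobiSym 3 5 = jacobiSym 5 3 :=
    jacobiSym.quadratic_reciprocity_one_mod_four' (by norm_num) (by norm_num)
  rw [h2]
  have h3 : jacobiSym 5 3 = jacobiSym 2 3 := jacobiSym.mod_left' (by decide)
  rw [h3, jacobiSym.at_two (by norm_num)]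
  decide

/-- Theorem 1.2 specialised to `R = 1`: full BSD (with `L(A,1) ≠ 0`, rank `0`, `#Ш` odd) for
`A = X₀(49)` on its minimal model `cm7`. [cite: CoatesLiTianZhai2015, Thm. 1.2 (case r = 0)] -/
theorem bsdTriple_cm7_of_thm12 (h : thm12_fullBSD_twist) [cm7.IsGloballyMinimal]
    (hC : ∃ C : VariableChange ℚ, C • cm7 = cm7.quadraticTwist ((1 : ℕ) : ℚ)) :
    cm7.entireLFunction 1 ≠ 0 ∧ cm7.mordellWeilRank = 0 ∧ cm7.ShaFinite ∧ Odd cm7.shaOrder ∧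
      cm7.BSDTriple :=
  h 1 inertProduct_one cm7 hC

/-! ### Theorem 4.4 (§4, Zhao's method): the exact `2`-adic valuation of `L^{(alg)}(A^{(R)}, 1)` -/

/-- **Coates–Li–Tian–Zhai 2015, Theorem 4.4** (PLMS 110 (2015) §4; arXiv:1312.3884 p0017 L54–L59,
verbatim): "Theorem 4.4. Let `q₁, ..., q_r` be `r ≥ 0` distinct primes, which are `≡ 1 mod 4` and
inert in `F`, and put `R = q₁⋯q_r`. Then `ord₂(L^{(alg)}(A^{(R)}, 1)) = r − 1`. In particular, we have
`L(A^{(R)}, 1) ≠ 0`." Here (p0004 L65–L70) "`L^{(alg)}(A^{(M)}, 1) = L(A^{(M)}, 1)/Ω_∞(A^{(M)})`, which is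
well known to be a rational number, where `Ω_∞(A^{(M)})` is the least positive real period of
`A^{(M)}`", and `ord₂(2) = 1`. This is the ANALYTIC HEART of Theorem 1.2 (p0017 L61–L72: "this result,
when combined with Corollary (descent3), implies Theorem (main3) … as `Ш(A^{(R)})(2) = 0` … and the
Tamagawa factors of `A^{(R)}` at the bad primes are given by `c₇ = 2, c_{q_i} = 2`, we see that the
`2`-part of the [conj.] is just the assertion that `ord₂(L^{(alg)}(A^{(R)}, 1)) = r − 1`"), proved by
Zhao's induction from `L^{(alg)}(A, 1) = 1/2` and the identity (4.3) (p0017 L44–L46). Transcription as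
for `thm13_ord_two_LAlg`: `R` with `InertProduct R`, `r = #R.primeFactors`; `A^{(R)}` read on a globally
minimal model `W'` (`∃ C, C • W' = cm7.quadraticTwist R`); `L(A^{(R)}, 1) = W'.entireLFunction 1`;
`Ω_∞(A^{(R)}) = leastRealPeriod W'`; the rational `L^{(alg)}` is an existential witness `q` with
`L(A^{(R)}, 1) = q · Ω_∞`, `q ≠ 0` ("in particular `L(A^{(R)}, 1) ≠ 0`") and `padicValRat 2 q = r − 1`.
For `r = 1` (`R = q` prime): `L(A^{(q)}, 1)/Ω_∞(A^{(q)})` is a `2`-adic UNIT — the input of the genus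
assembly of cell `bsd-goldfeld` (LINE B49, Theorem A), where it replaces the Tamagawa/torsion/`Ш`
bookkeeping of `A^{(q)}`. Named fact (PUBLISHED); nothing asserted; users take `(h : thm44_ord_two_LAlg)`.
[cite: CoatesLiTianZhai2015, Thm. 4.4 (§4; arXiv p0017 L54–L59), with the definition of L^{(alg)} (arXiv p0004 L65–L70)] -/
def thm44_ord_two_LAlg : Prop :=
  ∀ (R : ℕ), InertProduct R →
    ∀ (W' : WeierstrassCurve ℚ) [W'.IsElliptic] [W'.IsGloballyMinimal],
      (∃ C : VariableChange ℚ, C • W' = cm7.quadraticTwist (R : ℚ)) →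
        ∃ q : ℚ, W'.entireLFunction 1 = ((q * leastRealPeriod W' : ℝ) : ℂ) ∧ q ≠ 0 ∧
          padicValRat 2 q = ((R.primeFactors.card : ℕ) : ℤ) - 1

/-- A prime `q ≡ 1 (mod 4)` inert in `ℚ(√−7)` is an `InertProduct` with `r = 1`.
[cite: CoatesLiTianZhai2015, Thm. 1.2 (hypothesis on R, case r = 1)] -/
theorem inertProduct_prime {q : ℕ} (hq : q.Prime) (hq4 : q % 4 = 1) (hq7 : jacobiSym (-7) q = -1) :
    InertProduct q := by
  refine ⟨hq.squarefree, fun p hp hpq ↦ ?_⟩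
  have : p = q := (Nat.prime_dvd_prime_iff_eq hp hq).mp hpq
  subst this
  exact ⟨hq4, hq7⟩

/-- **Theorem 4.4 at `r = 1`**: for a prime `q ≡ 1 (mod 4)` inert in `ℚ(√−7)` and a globally minimal
model `W'` of `A^{(q)}`, `L(A^{(q)}, 1) = L^{(alg)} · Ω_∞(A^{(q)})` with `L^{(alg)} ∈ ℚ`, `L^{(alg)} ≠ 0`
and `ord₂ L^{(alg)} = 0` (unfolding of the cited theorem at `R = q`, `#R.primeFactors = 1`).
[cite: CoatesLiTianZhai2015, Thm. 4.4 (case r = 1)] -/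
theorem thm44_ord_two_LAlg.prime (h : thm44_ord_two_LAlg) {q : ℕ} (hq : q.Prime) (hq4 : q % 4 = 1)
    (hq7 : jacobiSym (-7) q = -1) (W' : WeierstrassCurve ℚ) [W'.IsElliptic] [W'.IsGloballyMinimal]
    (hC : ∃ C : VariableChange ℚ, C • W' = cm7.quadraticTwist (q : ℚ)) :
    ∃ r : ℚ, W'.entireLFunction 1 = ((r * leastRealPeriod W' : ℝ) : ℂ) ∧ r ≠ 0 ∧
      padicValRat 2 r = 0 := by
  obtain ⟨r, h1, h2, h3⟩ := h q (inertProduct_prime hq hq4 hq7) W' hC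
  refine ⟨r, h1, h2, ?_⟩
  rw [h3, Nat.Prime.primeFactors hq, Finset.card_singleton]
  norm_num

end Literature.NumberTheory.EllipticCurves.CoatesLiTianZhai2015

end
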